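import Summits.QuantumFields.YangMills.Theorems.UnitScaleTiltProp7CornerCombLinesInhabited
import HarnessLib

/-!
# Route `UnitScaleTilt`, crux K1 «MinimiserStabilityRegPr» (stmt-QuantumFields-19200), lane II (R-LEGS) ∕ route-R (β) (n3)-comb (II) —
# FILE F-9d-b (part 1) «THE SOURCELESS GAUGE ROW — DEFECT ROW AND KERNEL-TO-ROW BOOKKEEPING»: the two source-blind pieces of the sourceless gauge row `hrow₀`
# of ✓F-9d-a `Prop7CornerCombLinTowerCellRows.sum_cell_linTower_rows` that do NOT depend on the F-6d-3′ ∘ `gauge_row_kernel_le` fold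

Cell `ym3-torus`, width seat `ym3-torus-px18` (gen 5); pen F-9d ≡ F-8′ (★routeR-w1 g10 12:29:20Z; (a)(b) px18 g5, (c) ★routeR-w2 g10).  THEOREMS ONLY (0 `def`, 0 `sorry`);
`--supports stmt-QuantumFields-19200 --as helper`, count-neutral.  YM₃ on T³ is a ladder rung (R3), not the Clay problem; nothing here claims (hG), (hN′), `rlegs`, `hEng`,
`hMcomb`, (β), the stub, the crux, d = 4 or the mass gap.

THE POINT.  The gauge row of the SOURCELESS (linear-response) comb tower has no `σ·ỹ` feedback: per level, the three cell functionals of the reduced family `G = G^{lin}`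
that ★routeR-w6's F-6d-3′ `sum_cell_normSq_covGrad_gauge_le_of_le` reads — covariant gradient `Γ_i = g_i²`, mass `Μ_i = m_i²`, and the STEP DEFECT `Δ_i` (deviation of
`G_{i+1}` from the covariant block average of `G_i`) — close on `g`, `m` alone.  §1 ★ `sum_cell_stepDefect_sq_le_sourceless` — the sourceless twin of ✓F-8b-2 §5
`sum_cell_stepDefect_sq_le`: for `X_{j+1} = T_j(X_j) − ∇^{cov}F̂(X_j)` (the reduced recursion `hGlin`, NO source), `DEF_j ≤ (210(2d+2)L)²·α_j²·(2d)·MASS_j` (✓F-5c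
`Prop7CombTrueStepDefectCell.sum_cell_trueStep_defect_sq_le` after ✓cov-2 `smul_Q0cov_eq_sum`, lit ✓`avgIter_succ`; no `U₁`, no `tildIter`, no two-block sups).
§2 ★ `row_of_folded_kernel` (pure reals) — from a folded gauge row `λ_{k′+1}² ≤ Σ_{i≤k′}(ρ⁻¹)^{k′+1−i}·(cΓ·Γ_i + cΜ_i·Μ_i + cΔ·Δ_i)` (the shape of ✓p717111
`gauge_row_kernel_le`'s right side at `√L = ρ⁻¹`), `Γ_i = g_i²`, `Μ_i = m_i²`, `Δ_i ≤ CΔ_i·Μ_i`, `λ_0 = 0` and the letter dominations `cΓ ≤ wG`, `cΜ_i + cΔ·CΔ_i ≤ wM_i`: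
the displayed `hrow₀ : ∀ j ≤ k, λ_j² ≤ Σ_{i<j}(ρ⁻¹)^{j−i}·(wG·g_i² + wM_i·m_i²)` of ✓F-9d-a.  (Part 2 — the fold itself at `G := G^{lin}` — follows ★routeR-w6 g9's 5b-1 cut.)
HONEST SCOPE.  Bookkeeping; no estimate beyond ✓F-5c; `𝔸` any non-trivial C⋆-algebra in §1.

References: T. Bałaban, CMP **98** (1985) 17–51 [Balaban1985Averaging] ((42)–(43) pp.23–24, (68)–(69) p.29, Prop. 3 (122)–(126) p.36); CMP **109** (1987) 249–301
[Balaban1987RG1] ((0.1), (0.4) pp.251–253: the inductive gauge-row bookkeeping).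
-/

set_option autoImplicit false

noncomputable section

open scoped BigOperators
open Finset

namespace Summit.QuantumFields.YangMills.Theorems.Prop7CornerCombLinTowerGaugeRow

open NormedSpace
open Literature.MathematicalPhysics.QuantumFieldTheory.Balaban1983to89
open ExpMeanLog (eml)
open B7Prop1Explicit renaming Site → LSite
open B7Prop1Explicit (Letter e hol seg treeWord boxVec gammaWord plaqWord Wcx Xavg bavg expUnit U1)
open B7Prop2Explicit (avgIter avgIter_succ rescale_apply unitaryUnits unitaryUnits_le_U1)
open B7Eq78Linearization (conjR)
open B7Prop3GeneralRotated (tsum)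
open B7Prop3GeneralLinear (FhatCov Q0cov)
open Summit.QuantumFields.YangMills.Theorems.Prop7CombTrueStepDefectCell (sum_cell_trueStep_defect_sq_le)
open Summit.QuantumFields.YangMills.Theorems.Prop7CornerCombCovGradTransfer (smul_Q0cov_eq_sum)

variable {d : ℕ} {𝔸 : Type*} [CStarAlgebra 𝔸] [Nontrivial 𝔸]

/-! ## §1 ★ The step defect of the SOURCELESS reduced family -/

/-- ★ **THE SOURCELESS STEP-DEFECT ROW** (twin of ✓F-8b-2 §5 `sum_cell_stepDefect_sq_le` with NO source): coarse period `N′`, background `Ūʲ = avgIter L U₀ j` unitary,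
`X_j` coordinate-periodic at `N′L`, block loops `≤ α ≤ 1∕24`, and the REDUCED step `X_{j+1}(z,κ) = T_j(X_j)(z,κ) − (F̂(X_j)(L•z) − Ad_{Ūʲ⁺¹(z,κ)}F̂(X_j)(L•(z+e_κ)))`; then
`Σ_{μ,y}‖X_{j+1}(ŷ,μ) − Σ_{r,t}(Lᵈ)⁻¹·Ad_{hol}(X_j(L•ŷ + r + t•e_μ, μ))‖² ≤ (210(2d+2)L)²·α²·(2d)·Σ_{t′,ν}‖X_j(boxVec (N′L) t′, ν)‖²` — the deviation from the covariant block average IS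
the F-5a defect (`T − corner = L•Q₀ + DEF`, ✓cov-2 `smul_Q0cov_eq_sum`, lit ✓`avgIter_succ`), priced by ✓F-5c. [cite: Balaban1985Averaging, (42)-(43) pp.23-24, Prop. 3 (122)-(126) p.36] -/
theorem sum_cell_stepDefect_sq_le_sourceless (L N' : ℕ) (hL : 1 ≤ L) [NeZero N'] (U₀ : LSite d → Fin d → 𝔸ˣ) (j : ℕ)
    (hV : ∀ x μ, avgIter L U₀ j x μ ∈ unitaryUnits 𝔸) (Xj Xj1 : LSite d → Fin d → 𝔸)
    (hX : ∀ (x : LSite d) (κ μ : Fin d), Xj (x + ((N' * L : ℕ) : ℤ) • e κ) μ = Xj x μ)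
    {α : ℝ} (hα24 : α ≤ 1 / 24)
    (hα : ∀ (z : Fin d → Fin N') (κ : Fin d) (r : Fin d → Fin L), ‖((Wcx L (avgIter L U₀ j) ((L : ℤ) • boxVec N' z) κ (boxVec L r) : 𝔸ˣ) : 𝔸) - 1‖ ≤ α)
    (hXs : ∀ (z : LSite d) (κ : Fin d), Xj1 z κ
      = (fderiv ℂ (eml : ((Fin d → Fin L) → 𝔸) → 𝔸) (fun r => ((Wcx L (avgIter L U₀ j) ((L : ℤ) • z) κ (boxVec L r) : 𝔸ˣ) : 𝔸))
            (fun r => tsum (avgIter L U₀ j) Xj ((L : ℤ) • z) (gammaWord L κ (boxVec L r) ++ seg κ (-(L : ℤ)))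
              * ((Wcx L (avgIter L U₀ j) ((L : ℤ) • z) κ (boxVec L r) : 𝔸ˣ) : 𝔸))
            * (((expUnit (Xavg L (avgIter L U₀ j) ((L : ℤ) • z) κ))⁻¹ : 𝔸ˣ) : 𝔸)
          + ((expUnit (Xavg L (avgIter L U₀ j) ((L : ℤ) • z) κ) : 𝔸ˣ) : 𝔸) * tsum (avgIter L U₀ j) Xj ((L : ℤ) • z) (seg κ (L : ℤ))
            * (((expUnit (Xavg L (avgIter L U₀ j) ((L : ℤ) • z) κ))⁻¹ : 𝔸ˣ) : 𝔸))
        - (FhatCov L (avgIter L U₀ j) Xj ((L : ℤ) • z) - conjR (avgIter L U₀ (j + 1) z κ) (FhatCov L (avgIter L U₀ j) Xj ((L : ℤ) • (z + e κ))))) :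
    ∑ μ : Fin d, ∑ y : Fin d → Fin N', ‖Xj1 (boxVec N' y) μ
        - ∑ r : Fin d → Fin L, ∑ t ∈ Finset.range L, (((L : ℝ) ^ d)⁻¹) •
            conjR (hol (avgIter L U₀ j) ((L : ℤ) • boxVec N' y) (treeWord (boxVec L r) ++ seg μ (t : ℤ))) (Xj ((L : ℤ) • boxVec N' y + boxVec L r + (t : ℤ) • e μ) μ)‖ ^ 2
      ≤ (210 * ((2 * d + 2) * L)) ^ 2 * α ^ 2 * (2 * d) * ∑ t' : Fin d → Fin (N' * L), ∑ ν : Fin d, ‖Xj (boxVec (N' * L) t') ν‖ ^ 2 := by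
  -- the F-5a defect as a letter
  obtain ⟨D, hD⟩ : ∃ D : (Fin d → Fin N') → Fin d → 𝔸, ∀ (y : Fin d → Fin N') (μ : Fin d), D y μ
      = fderiv ℂ (eml : ((Fin d → Fin L) → 𝔸) → 𝔸) (fun r => ((Wcx L (avgIter L U₀ j) ((L : ℤ) • boxVec N' y) μ (boxVec L r) : 𝔸ˣ) : 𝔸))
            (fun r => tsum (avgIter L U₀ j) Xj ((L : ℤ) • boxVec N' y) (gammaWord L μ (boxVec L r) ++ seg μ (-(L : ℤ)))
              * ((Wcx L (avgIter L U₀ j) ((L : ℤ) • boxVec N' y) μ (boxVec L r) : 𝔸ˣ) : 𝔸))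
            * (((expUnit (Xavg L (avgIter L U₀ j) ((L : ℤ) • boxVec N' y) μ))⁻¹ : 𝔸ˣ) : 𝔸)
          + ((expUnit (Xavg L (avgIter L U₀ j) ((L : ℤ) • boxVec N' y) μ) : 𝔸ˣ) : 𝔸) * tsum (avgIter L U₀ j) Xj ((L : ℤ) • boxVec N' y) (seg μ (L : ℤ))
            * (((expUnit (Xavg L (avgIter L U₀ j) ((L : ℤ) • boxVec N' y) μ))⁻¹ : 𝔸ˣ) : 𝔸)
          - (FhatCov L (avgIter L U₀ j) Xj ((L : ℤ) • boxVec N' y)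
              - conjR (bavg L (avgIter L U₀ j) ((L : ℤ) • boxVec N' y) μ) (FhatCov L (avgIter L U₀ j) Xj ((L : ℤ) • boxVec N' y + (L : ℤ) • e μ))
              + (L : ℝ) • Q0cov L (avgIter L U₀ j) Xj ((L : ℤ) • boxVec N' y) μ) := ⟨fun y μ => _, fun _ _ => rfl⟩
  -- pointwise: deviation from the straight step = F-5a defect (no source)
  have hdec : ∀ (y : Fin d → Fin N') (μ : Fin d), Xj1 (boxVec N' y) μ
        - ∑ r : Fin d → Fin L, ∑ t ∈ Finset.range L, (((L : ℝ) ^ d)⁻¹) •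
            conjR (hol (avgIter L U₀ j) ((L : ℤ) • boxVec N' y) (treeWord (boxVec L r) ++ seg μ (t : ℤ))) (Xj ((L : ℤ) • boxVec N' y + boxVec L r + (t : ℤ) • e μ) μ)
      = D y μ := by
    intro y μ
    rw [hD, hXs, smul_add, ← smul_Q0cov_eq_sum L hL, avgIter_succ, rescale_apply]
    abel
  have hF5c := sum_cell_trueStep_defect_sq_le L N' hL (avgIter L U₀ j) hV Xj hX hα hα24
  simp only [← hD] at hF5c
  calc ∑ μ : Fin d, ∑ y : Fin d → Fin N', ‖Xj1 (boxVec N' y) μ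
          - ∑ r : Fin d → Fin L, ∑ t ∈ Finset.range L, (((L : ℝ) ^ d)⁻¹) •
              conjR (hol (avgIter L U₀ j) ((L : ℤ) • boxVec N' y) (treeWord (boxVec L r) ++ seg μ (t : ℤ))) (Xj ((L : ℤ) • boxVec N' y + boxVec L r + (t : ℤ) • e μ) μ)‖ ^ 2
      = ∑ μ : Fin d, ∑ y : Fin d → Fin N', ‖D y μ‖ ^ 2 := by simp_rw [hdec]
    _ = ∑ y : Fin d → Fin N', ∑ μ : Fin d, ‖D y μ‖ ^ 2 := Finset.sum_comm
    _ ≤ _ := hF5c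

/-! ## §2 ★ From a folded gauge row to the displayed sourceless row (pure reals) -/

omit [CStarAlgebra 𝔸] [Nontrivial 𝔸] in
/-- ★ **KERNEL-TO-ROW BOOKKEEPING (sourceless).**  Reals: a kernel letter `s > 0`; sequences `g m lam Γ Μ Δ CΔ cΜ wM`; letters `cΓ cΔ wG`.  HYPOTHESES: `λ_0 = 0`; for `i < k`,
`Γ_i = g_i²`, `Μ_i = m_i²`, `Δ_i ≤ CΔ_i·Μ_i`; `0 ≤ cΔ`; the letter dominations `cΓ ≤ wG`, `cΜ_i + cΔ·CΔ_i ≤ wM_i` (`i < k`); and the FOLDED gauge row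
`∀ k′ < k, λ_{k′+1}² ≤ Σ_{i ∈ range(k′+1)} s^{k′+1−i}·(cΓ·Γ_i + cΜ_i·Μ_i + cΔ·Δ_i)` (the right side of ✓p717111 `gauge_row_kernel_le` at `√L = s`).
CONCLUSION: `∀ j ≤ k, λ_j² ≤ Σ_{i<j} s^{j−i}·(wG·g_i² + wM_i·m_i²)` — ✓F-9d-a's displayed `hrow₀` at `s = ρ⁻¹`. [Balaban1987RG1 (0.4) p.253, scalar bookkeeping] -/
theorem row_of_folded_kernel {s cΓ cΔ wG : ℝ} (hs : 0 < s) (hcΔ : 0 ≤ cΔ) {k : ℕ} (g m lam Γ Μ Δ CΔ cΜ wM : ℕ → ℝ)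
    (hlam0 : lam 0 = 0) (hΓ : ∀ i < k, Γ i = g i ^ 2) (hΜ : ∀ i < k, Μ i = m i ^ 2) (hΔ : ∀ i < k, Δ i ≤ CΔ i * Μ i)
    (hdomG : cΓ ≤ wG) (hdomM : ∀ i < k, cΜ i + cΔ * CΔ i ≤ wM i)
    (hfold : ∀ k' < k, lam (k' + 1) ^ 2 ≤ ∑ i ∈ Finset.range (k' + 1), s ^ (k' + 1 - i) * (cΓ * Γ i + cΜ i * Μ i + cΔ * Δ i)) :
    ∀ j ≤ k, lam j ^ 2 ≤ ∑ i ∈ Finset.range j, s ^ (j - i) * (wG * g i ^ 2 + wM i * m i ^ 2) := by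
  intro j hj
  cases j with
  | zero => simp [hlam0]
  | succ k' =>
    have hk' : k' < k := by omega
    refine (hfold k' hk').trans (Finset.sum_le_sum fun i hi => ?_)
    have hik : i < k := lt_of_lt_of_le (Finset.mem_range.mp hi) (by omega)
    have hs0 : 0 ≤ s ^ (k' + 1 - i) := pow_nonneg hs.le _
    refine mul_le_mul_of_nonneg_left ?_ hs0
    rw [hΓ i hik, hΜ i hik]
    have hm2 : 0 ≤ m i ^ 2 := sq_nonneg _
    have hg2 : 0 ≤ g i ^ 2 := sq_nonneg _
    have h1 : cΔ * Δ i ≤ cΔ * (CΔ i * m i ^ 2) := by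
      have := hΔ i hik; rw [hΜ i hik] at this; exact mul_le_mul_of_nonneg_left this hcΔ
    have h2 : cΓ * g i ^ 2 ≤ wG * g i ^ 2 := mul_le_mul_of_nonneg_right hdomG hg2
    have h3 : (cΜ i + cΔ * CΔ i) * m i ^ 2 ≤ wM i * m i ^ 2 := mul_le_mul_of_nonneg_right (hdomM i hik) hm2
    nlinarith [h1, h2, h3]

end Summit.QuantumFields.YangMills.Theorems.Prop7CornerCombLinTowerGaugeRow

end
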